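import Literature.NumberTheory.GaloisRepresentations.AbsGaloisIndexPNormalOpen
import Literature.NumberTheory.GaloisRepresentations.LocalFieldFiniteExtension
import Literature.NumberTheory.GaloisRepresentations.LocalGaloisGroupInertiaProofs
import Literature.AnabelianGeometry.AbsoluteAnabelian.GaloisSubextensionProofs
import HarnessLib

/-!
# Strong completeness of the absolute Galois group of a `p`-adic field

Let `F` be a non-archimedean local field of characteristic `0` whose absolute Galois group
`Γ_F = Gal(F̄/F)` is topologically finitely generated (unconditional: [NSW] Thm. 7.5.10, tree
`Summits/ABC/IUTFork/MLFGaloisTFG.lean`).  Then **every subgroup of finite index of `Γ_F` is open**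
(`isOpen_of_finiteIndex_absoluteGaloisGroup`): the instance at `G_k` of the theorem of Nikolov–Segal
(*Finite index subgroups in profinite groups*, C. R. Acad. Sci. 337 (2003); Ann. of Math. 165 (2007),
Thm. 1.1) quoted in [IUTchI] Rmk. 2.5.3 (vi) — the cell abc-iut's FACT F-1977 at `G_k` (GAP row
G-L3d2g2-1) — proved here by an elementary route:

1. abc-iut-w5-d200's reduction `MLFGaloisTameStronglyComplete.forall_finiteIndex_isOpen_iff_index_p`:
   strong completeness of `Γ_F` ⟺ for every open `V ≤ Γ_F`, every `V`-normal `V₁ ≤ V` of index `p` is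
   open (the tame quotient `Γ_F ⧸ P_F` being strongly complete, abelian-by-abelian and procyclic);
2. `isOpen_of_normal_of_index_eq_ringChar` (sibling file `AbsGaloisIndexPNormalOpen`): normal subgroups
   of index `p` of `Γ_E` are open for EVERY such field `E` — the wild inertia group is topologically
   normally finitely generated, so the operator form of Serre's lemma
   (`Literature/GroupTheory/ProP/OperatorFrattiniOpen.lean`) applies;
3. `isOpen_of_relIndex_eq_ringChar_of_isOpen` (here): an open `V ≤ Γ_F` is `Gal(F̄/E) ≅ Γ_E` for a
   finite `E/F` (`exists_intermediateField_of_isOpen_absoluteGaloisGroup`,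
   `nonempty_continuousMulEquiv_fixingSubgroup`), `E` is again a non-archimedean local field of
   characteristic `0` with the same residue characteristic (`FiniteExtension.isNonarchimedeanLocalField`,
   `natCast_ringChar_residueField_eq_zero`) and `Γ_E` is topologically finitely generated (open
   subgroup of `Γ_F`); transport 2.

HONEST SCOPE: classical; `p`-adic fields only (not the general Nikolov–Segal theorem, which stays the
named fact `Literature.GroupTheory.NikolovSegalStatement`); nothing here bears on [IUTchIII] Cor. 3.12.
Proof-only (no definitions).
[cite: NikolovSegal2003, Thm 1.1] [cite: Mochizuki2012, IUTchI Rmk 2.5.3 (vi) (O3) p.56]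
[cite: SerreGaloisCohomology1997, I §4.2 ex. 6]
-/

noncomputable section

open scoped Pointwise Valued
open Field ValuativeRel

namespace Literature.NumberTheory.GaloisRepresentations

open GaloisRepresentations.IsNonarchimedeanLocalField
open Literature.AnabelianGeometry.AbsoluteAnabelian

variable (F : Type) [Field F] [ValuativeRel F] [TopologicalSpace F] [IsNonarchimedeanLocalField F]
  [CharZero F]

/-- **Transport to open subgroups.**  For `Γ_F` topologically finitely generated (`F` of characteristic
`0`, residue characteristic `p`), `V ≤ Γ_F` open and `V₁ ≤ V` normal in `V` of index `[V : V₁] = p`,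
`V₁` is open: `V = Gal(F̄/E) ≅ Γ_E` for a finite extension `E/F`, a non-archimedean local field of
characteristic `0` and residue characteristic `p` with `Γ_E` topologically finitely generated, where
`isOpen_of_normal_of_index_eq_ringChar` applies. [cite: NikolovSegal2003, Thm 1.1]
[cite: SerreGaloisCohomology1997, I §4.2 ex. 6] -/
theorem isOpen_of_relIndex_eq_ringChar_of_isOpen
    (hG : IsTopologicallyFinitelyGenerated (absoluteGaloisGroup F))
    (V V₁ : Subgroup (absoluteGaloisGroup F)) (hV : IsOpen (V : Set (absoluteGaloisGroup F)))
    (hle : V₁ ≤ V) (hnorm : ∀ v ∈ V, ∀ x ∈ V₁, v * x * v⁻¹ ∈ V₁)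
    (hidx : V₁.relIndex V = ringChar 𝓀[F]) :
    IsOpen (V₁ : Set (absoluteGaloisGroup F)) := by
  classical
  -- `V = Gal(F̄/E)`, `E/F` finite
  obtain ⟨E, hfd, -, hEV⟩ := exists_intermediateField_of_isOpen_absoluteGaloisGroup F V hV
  haveI := hfd
  subst hEV
  set W : Subgroup (absoluteGaloisGroup F) :=
    E.fixingSubgroup.comap (absoluteGaloisGroup.toAlgEquiv F).toMonoidHom with hW
  obtain ⟨e⟩ := nonempty_continuousMulEquiv_fixingSubgroup F E
  -- `E` as a non-archimedean local field of characteristic `0`, residue characteristic `p`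
  letI := FiniteExtension.valuativeRel F E
  letI := FiniteExtension.topologicalSpace F E
  haveI : IsNonarchimedeanLocalField E := FiniteExtension.isNonarchimedeanLocalField F E
  haveI : CharZero E := charZero_of_injective_algebraMap (algebraMap F E).injective
  have hpF : (ringChar 𝓀[F]).Prime := ringChar_residueField_prime (F := F)
  have hpE : (ringChar 𝓀[E]).Prime := ringChar_residueField_prime (F := E)
  have hchar : ringChar 𝓀[E] = ringChar 𝓀[F] := by
    have h0 : ((ringChar 𝓀[E] : ℕ) : 𝓀[F]) = 0 := natCast_ringChar_residueField_eq_zero (F := F) (E := E)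
    have hdvd : ringChar 𝓀[F] ∣ ringChar 𝓀[E] := (ringChar.spec 𝓀[F] _).mp h0
    exact ((Nat.prime_dvd_prime_iff_eq hpF hpE).mp hdvd).symm
  -- `Γ_E` is topologically finitely generated
  have hGE : IsTopologicallyFinitelyGenerated (absoluteGaloisGroup E) :=
    (hG.subgroup_isOpen W hV).of_continuousMulEquiv e
  -- transport `V₁` to a normal subgroup of index `p` of `Γ_E`
  haveI hn : (V₁.subgroupOf W).Normal :=
    ⟨fun x hx v => Subgroup.mem_subgroupOf.mpr (by
      simpa only [Subgroup.coe_mul, Subgroup.coe_inv] using hnorm v v.2 x (Subgroup.mem_subgroupOf.mp hx))⟩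
  set N' : Subgroup (absoluteGaloisGroup E) :=
    (V₁.subgroupOf W).map (e.toMulEquiv : W →* absoluteGaloisGroup E) with hN'
  haveI : N'.Normal := Subgroup.Normal.map hn _ e.surjective
  have hidx' : N'.index = ringChar 𝓀[E] := by
    rw [hN', Subgroup.index_map_equiv, hchar]
    exact hidx
  have hopen' : IsOpen (N' : Set (absoluteGaloisGroup E)) :=
    isOpen_of_normal_of_index_eq_ringChar E hGE N' hidx'
  -- pull back to `W` and push into `Γ_F`
  have hpre : ((V₁.subgroupOf W : Subgroup W) : Set W) = e ⁻¹' (N' : Set (absoluteGaloisGroup E)) := by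
    ext x
    simp only [SetLike.mem_coe, Set.mem_preimage, hN']
    constructor
    · intro hx; exact Subgroup.mem_map_of_mem _ hx
    · intro hx
      obtain ⟨y, hy, hyx⟩ := Subgroup.mem_map.mp hx
      have hyx' : e y = e x := hyx
      have : y = x := e.injective hyx'
      rw [← this]; exact hy
  have hopenW : IsOpen (((V₁.subgroupOf W : Subgroup W)) : Set W) := by
    rw [hpre]; exact hopen'.preimage (map_continuous e)
  have hset : (V₁ : Set (absoluteGaloisGroup F)) = Subtype.val '' ((V₁.subgroupOf W : Subgroup W) : Set W) := by
    ext x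
    simp only [SetLike.mem_coe, Set.mem_image, Subgroup.mem_subgroupOf, Subtype.exists, exists_and_right,
      exists_eq_right]
    exact ⟨fun hx => ⟨hle hx, hx⟩, fun ⟨_, hx⟩ => hx⟩
  rw [hset]
  exact hV.isOpenMap_subtype_val _ hopenW

/-- **The absolute Galois group of a `p`-adic field is strongly complete**: for `F` a non-archimedean
local field of characteristic `0` with `Γ_F` topologically finitely generated, every subgroup of finite
index of `Γ_F = Gal(F̄/F)` is open.  (The `G_k` instance of the Nikolov–Segal theorem quoted in
[IUTchI] Rmk. 2.5.3 (vi); abc-iut FACT F-1977 at `G_k`.)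
[cite: NikolovSegal2003, Thm 1.1] [cite: Mochizuki2012, IUTchI Rmk 2.5.3 (vi) (O3) p.56] -/
theorem isOpen_of_finiteIndex_absoluteGaloisGroup
    (hG : IsTopologicallyFinitelyGenerated (absoluteGaloisGroup F))
    (K : Subgroup (absoluteGaloisGroup F)) [K.FiniteIndex] :
    IsOpen (K : Set (absoluteGaloisGroup F)) := by
  obtain ⟨ϖ, hϖ⟩ := IsDiscreteValuationRing.exists_irreducible 𝒪[F]
  exact (MLFGaloisTameStronglyComplete.forall_finiteIndex_isOpen_iff_index_p F hG hϖ).mpr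
    (fun V V₁ hV hle hnorm hidx => isOpen_of_relIndex_eq_ringChar_of_isOpen F hG V V₁ hV hle hnorm hidx)
    K inferInstance

/-- **Every homomorphism from `Γ_F` to a finite group is continuous** (`F` of characteristic `0`,
`Γ_F` topologically finitely generated): its kernel has finite index, hence is open.
[cite: NikolovSegal2003, Thm 1.1] -/
theorem isOpen_ker_of_finite_absoluteGaloisGroup
    (hG : IsTopologicallyFinitelyGenerated (absoluteGaloisGroup F))
    {H : Type*} [Group H] [Finite H] (f : absoluteGaloisGroup F →* H) :
    IsOpen ((f.ker : Subgroup (absoluteGaloisGroup F)) : Set (absoluteGaloisGroup F)) := by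
  haveI : f.ker.FiniteIndex := by
    refine ⟨?_⟩
    rw [Subgroup.index_ker]
    exact Nat.card_pos.ne'
  exact isOpen_of_finiteIndex_absoluteGaloisGroup F hG f.ker

/-- The statement in the shape of the named fact `Literature.GroupTheory.NikolovSegalStatement`, AT
`Γ_F` (`F` a non-archimedean local field of characteristic `0`): if `Γ_F` is topologically finitely
generated then every finite-index subgroup is open. [cite: NikolovSegal2003, Thm 1.1]
[cite: Mochizuki2012, IUTchI Rmk 2.5.3 (vi) (O3) p.56] -/
theorem forall_finiteIndex_isOpen_absoluteGaloisGroup_of_tfg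
    (hG : IsTopologicallyFinitelyGenerated (absoluteGaloisGroup F)) :
    ∀ K : Subgroup (absoluteGaloisGroup F), K.FiniteIndex → IsOpen (K : Set (absoluteGaloisGroup F)) :=
  fun K hK => by haveI := hK; exact isOpen_of_finiteIndex_absoluteGaloisGroup F hG K

end Literature.NumberTheory.GaloisRepresentations

end
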